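import Literature.MathematicalPhysics.QuantumFieldTheory.Balaban1983to89.B9SectBStepUGuardedR
import Literature.MathematicalPhysics.QuantumFieldTheory.Balaban1983to89.B9Thm39ReadingCoords

/-!
# Balaban [B9], Thm 3.4 p. 400 / Sect. B pp. 400–407 — THE (α3) FACE `sectBStepU_C37GY_unitary_extraYPb_d261Y` WITH ITS STRUCTURAL BINDERS DISCHARGED:
# the real-basis coordinate data `M₂ hM₂ hrepr hcR hcL` (any basis of `M_N(ℂ)`, finite dimension) and the neighbour count `mN hnbr` (from [4] Lemma 2.1 (2.61))
# (pub-ymgap N06, seat dag-n06-c g18; count-neutral supply for the next edition of the N06 certificate after FLAG №8)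

T. Bałaban, *Propagators for lattice gauge theories in a background field*, Commun. Math. Phys. **99** (1985) 389–434 [`Balaban1985BackgroundPropagators`, "B9"],
Thm 3.4 p. 400, Sect. B pp. 400–407, (3.35) p. 396, p. 397 («Δ̃(y)»), Thm 3.11 p. 416; [4] = T. Bałaban, *Propagators and renormalization transformations for lattice
gauge theories. II*, Commun. Math. Phys. **96** (1984) 223–250 [`Balaban1984PropagatorsII`], Lemma 2.1 (2.59)–(2.61) pp. 233–234.

statement-level skeleton of published theorems with citation tags; proofs where landed; nothing here is a claim about the Yang–Mills mass gap

WHY THIS FILE (cell context).  The (α3) object of record `B9SectBStepUGuardedR.sectBStepU_C37GY_unitary_extraYPb_d261Y` (p726389), consumed BY NAME by the N06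
certificate (edition 76 «UB» and successors), DISPLAYS — besides print's inputs `hunitA` (GUARDED Thm 3.11), `h32 h33` and the numerics — two groups of purely
STRUCTURAL binders that the certificate re-displays verbatim: (i) for the real basis `b` of `M_N(ℂ)` in which the Hölder readings are coordinatised, a coordinate
bound `M₂` with `hM₂ : 0 ≤ M₂`, `hrepr : |b.repr v j| ≤ M₂‖v‖`, `hcR : 0 < M₂ Σ‖b j‖`, `hcL : 0 < √|ι| M₂ Σ‖b j‖`; (ii) a neighbour count `mN` with
`hnbr : #{y″ : d(y″, y′) ≤ 2(d+1)} ≤ mN` on the index bonds of every member.  Both are THEOREMS: (i) in finite dimension every basis has the operator-norm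
coordinate bound `coordBound39 b` (dag-n06-j∕-k `B9Thm39ReadingCoords.abs_repr_le`), positive together with `Σ‖b j‖` as soon as `N ≥ 1`; (ii) is this topic's
corollary of [4] (2.61) at def-Y's members, `B9GeoNbrCountKLevelV1.hnbr_of_le`, under ONE member-floor threshold `nbrM₀Y … (2(d+1)) ≤ M⋆` (the species the
certificate already displays for radius 2 as `hM₀`).

WHAT IS PROVED (sorry-free; standard axioms; 0 `def`; nothing of [B9] asserted).
* §1 (any normed `ℂ`-algebra `𝔸`, finite-dimensional over `ℝ`, nontrivial; any real basis `b`): `basisBound39_pos` (`0 < Σ‖b j‖`), `coordBound39_pos`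
  (`0 < coordBound39 b`), ★ `hcR_of_basis`, ★ `hcL_of_basis` — the two positivity binders of the (α3) face at `M₂ := coordBound39 b`.
* §2 ★★★ `sectBStepU_C37GY_unitary_extraYPb_d261Y_std` ∕ ★★ `thm34U_C37GY_unitary_extraYPb_d261Y_std` — §4b of `B9SectBStepUGuardedR` with
  `(M₂, hM₂, hrepr, hcR, hcL)` SUPPLIED at `coordBound39 b` and `(mN, hnbr)` SUPPLIED at `nbrCountY d ℓ hd hL b₀ b₁ (2(d+1))` from the ONE displayed threshold
  `hM₀B : nbrM₀Y d ℓ hd hL b₀ b₁ (2(d+1)) ≤ M⋆`; every other binder (`hG hι hG1`, `MInv aInv aW hMInv haInv haW`, GUARDED `hunitA`, `hb₁ hMd hMr`, `h32 h33`) and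
  the conclusion VERBATIM.  Net for a consumer: seven displayed binders become one member-floor threshold.

HONEST SCOPE.  Bookkeeping: two structural displays of a landed reduction are theorems of finite-dimensional linear algebra and of the tree's (2.61); nothing of
[B9]'s estimates is asserted or proved; `hunitA` (print's Theorem 3.11 on the class, guarded by its thresholds), `h32 h33` and the numerics stay displayed; NOT a
node discharge; COUNT-NEUTRAL; N06 NOT discharged; nothing continuum ∕ ℝ⁴ ∕ OS ∕ mass gap ∕ Clay.  Cell `pub-ymgap` (HUMAN RULING D-0062), Track A node N06 [B9],
seat `pub-ymgap-dag-n06-c` g18, 2026-08-29.  NEW file; nothing landed is modified.  Net new unproved facts: 0.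
-/

noncomputable section

namespace Literature.MathematicalPhysics.QuantumFieldTheory.Balaban1983to89.B9SectBStepUStructuralKit

open B9Thm39ReadingCoords (coordBound39 basisBound39 abs_repr_le)

/-! ## §1 The coordinate data of a real basis in finite dimension -/

section Basis

variable {𝔸 : Type} [NormedRing 𝔸] [NormedAlgebra ℂ 𝔸] [FiniteDimensional ℝ 𝔸] [Nontrivial 𝔸]
variable {κ : Type} [Fintype κ] (b : Module.Basis κ ℝ 𝔸)

omit [FiniteDimensional ℝ 𝔸] in
/-- `0 < Σ_c ‖b_c‖` for a basis of a nontrivial space (a basis vector is nonzero). [cite: Balaban1985BackgroundPropagators, p.389 (𝔤-valued functions), bookkeeping] -/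
theorem basisBound39_pos : 0 < basisBound39 b := by
  obtain ⟨c⟩ := b.index_nonempty
  have hc : 0 < ‖b c‖ := norm_pos_iff.2 (b.ne_zero c)
  exact lt_of_lt_of_le hc (Finset.single_le_sum (f := fun c => ‖b c‖) (fun _ _ => norm_nonneg _) (Finset.mem_univ c))

/-- `0 < coordBound39 b`: the coordinate functional of a basis vector takes the value `1`. [cite: Balaban1985BackgroundPropagators, p.389, bookkeeping] -/
theorem coordBound39_pos : 0 < coordBound39 b := by
  obtain ⟨c⟩ := b.index_nonempty
  have h1 : |b.repr (b c) c| ≤ coordBound39 b * ‖b c‖ := abs_repr_le b (b c) c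
  rw [b.repr_self, Finsupp.single_eq_same, abs_one] at h1
  have hc : 0 < ‖b c‖ := norm_pos_iff.2 (b.ne_zero c)
  by_contra h
  push Not at h
  have : coordBound39 b * ‖b c‖ ≤ 0 := mul_nonpos_of_nonpos_of_nonneg h hc.le
  linarith

/-- ★ the (α3) face's binder `hcR : 0 < M₂ · Σ‖b j‖` at `M₂ := coordBound39 b`. [cite: Balaban1985BackgroundPropagators, Sect. B p.400 (coordinates of the readings), bookkeeping] -/
theorem hcR_of_basis : 0 < coordBound39 b * ∑ j, ‖b j‖ :=
  mul_pos (coordBound39_pos b) (basisBound39_pos b)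

/-- ★ the (α3) face's binder `hcL : 0 < √|ι| · M₂ · Σ‖b j‖` at `M₂ := coordBound39 b`. [cite: Balaban1985BackgroundPropagators, Sect. B p.400, bookkeeping] -/
theorem hcL_of_basis : 0 < Real.sqrt (Fintype.card κ) * coordBound39 b * ∑ j, ‖b j‖ := by
  obtain ⟨c⟩ := b.index_nonempty
  have hκ : 0 < (Fintype.card κ : ℝ) := Nat.cast_pos.2 (Fintype.card_pos_iff.2 ⟨c⟩)
  exact mul_pos (mul_pos (Real.sqrt_pos.2 hκ) (coordBound39_pos b)) (basisBound39_pos b)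

end Basis

/-! ## §2 ★★★ The (α3) face with the structural binders discharged -/

section Face

open scoped Matrix.Norms.L2Operator
open B6Ineq2142KLevelV1 (β)
open B9PinMembersKLevelV1 (MemberY geo9Y)
open B9Eq360DeltaPrimeAY (AfldY)
open B9SectBCodedClassR (bg9YC extraYPb)
open B9SectBCodedReadingsUR (SectBStepU Thm34U)
open B9SectBKerFrameCodedYR (CinvY)
open B9SectBCodedClassGY (C37GY)
open B9Eq340TaxiContourLocalityY (rLB)
open B9RWSumsReadsNbr (nbr)
open B9GeoNbrCountKLevelV1 (nbrM₀Y nbrCountY hnbr_of_le)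
open B9SectBStepUGuardedR (sectBStepU_C37GY_unitary_extraYPb_d261Y thm34U_C37GY_unitary_extraYPb_d261Y)
open Node00 (SiteY BlkY FBondY IBondY CfgY GAY GpY deltaAY parSymY parBY kernelFamilyS kernelFamilyB)

variable {d ℓ : ℕ} {hd : 1 ≤ d + 1} {hL : Odd (ℓ + 1) ∧ 1 < ℓ + 1} {b₀ b₁ : ℝ} {Mstar : ℕ}
variable {N : ℕ} {J : Type} (f : J → MemberY d ℓ hd hL b₀ b₁ Mstar) [∀ x : MemberY d ℓ hd hL b₀ b₁ Mstar, Fintype (geo9Y x).Site]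
  [instDS : ∀ x : MemberY d ℓ hd hL b₀ b₁ Mstar, DecidableEq (geo9Y x).Site] [instNE : ∀ x : MemberY d ℓ hd hL b₀ b₁ Mstar, Nonempty (geo9Y x).Site]
  (c35 : ℝ) (G : Subgroup (Matrix (Fin N) (Fin N) ℂ)ˣ) {ι : Type} [Fintype ι] [DecidableEq ι] (b : Module.Basis ι ℝ (Matrix (Fin N) (Fin N) ℂ))
  (ιB : ∀ j : J, BlkY (f j).toKIdx → IBondY (f j).toKIdx)
  (C38 : ∀ j : J, ℝ → CfgY (Matrix (Fin N) (Fin N) ℂ) (f j).toKIdx → AfldY (Matrix (Fin N) (Fin N) ℂ) (f j).toKIdx → Prop)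

/-- ★★★ **THE (α3) FACE WITH ITS STRUCTURAL BINDERS DISCHARGED**: `B9SectBStepUGuardedR.sectBStepU_C37GY_unitary_extraYPb_d261Y` (Theorem 3.4's Sect.-B step in
U-letters at the record's reading of print's class, `𝔸 = M_N(ℂ)`, `G ≦ U(N)`, Lemma-2.1 datum discharged) with the real-basis coordinate data SUPPLIED at
`M₂ := coordBound39 b` (`abs_repr_le`, `hcR_of_basis`, `hcL_of_basis`) and the neighbour count SUPPLIED at `mN := nbrCountY d ℓ hd hL b₀ b₁ (2(d+1))`
(`hnbr_of_le`) from the ONE displayed member-floor threshold `hM₀B`.  STILL DISPLAYED (print-intrinsic or numeric): `hG hι hG1`, `MInv aInv aW` with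
`hMInv haInv haW hMd hMr`, the GUARDED Thm-3.11 input `hunitA`, `hb₁`, the record's Thms 3.2 ∕ 3.3 `h32 h33`; `C38` free; `N ≥ 1`.
[cite: Balaban1985BackgroundPropagators, Thm 3.4 p.400, Sect. B pp.400–407, (3.35) p.396, p.397 (Δ̃(y)), Thm 3.11 p.416; Balaban1984PropagatorsII, Lemma 2.1 (2.59)–(2.61) pp.233–234] -/
theorem sectBStepU_C37GY_unitary_extraYPb_d261Y_std [Nonempty (Fin N)] [NormOneClass (Matrix (Fin N) (Fin N) ℂ)] [FiniteDimensional ℝ (Matrix (Fin N) (Fin N) ℂ)]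
    (hG : G ≤ B7Prop2Explicit.unitaryUnits (Matrix (Fin N) (Fin N) ℂ))
    (hι : ∀ (j : J) (s : BlkY (f j).toKIdx), β (f j).toKIdx.hN (f j).toKIdx.D (f j).toKIdx.hk (ιB j s) = s)
    (hG1 : ∀ u : (Matrix (Fin N) (Fin N) ℂ)ˣ, u ∈ G → ‖(u : Matrix (Fin N) (Fin N) ℂ)‖ ≤ 1)
    (MInv aInv aW : ℝ) (hMInv : 0 < MInv) (haInv : 0 < aInv) (haW : 0 < aW)
    (hunitA : ∀ j (α₀ : ℝ) (U : CfgY (Matrix (Fin N) (Fin N) ℂ) (f j).toKIdx), MInv ≤ (geo9Y (f j)).M → 0 < α₀ → (geo9Y (f j)).M * α₀ ≤ aInv →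
      (bg9YC (Matrix (Fin N) (Fin N) ℂ) G (extraYPb (Matrix (Fin N) (Fin N) ℂ) G) (f j)).Reg335 c35 α₀ U →
      IsUnit (deltaAY (f j).toKIdx (parSymY (f j).toKIdx) (parBY (f j).toKIdx) (GpY (f j).toKIdx (parSymY (f j).toKIdx)) U)) (hb₁ : 0 ≤ b₁)
    (hMd : 2 * ((d : ℝ) + 1) < MInv) (hM₀B : nbrM₀Y d ℓ hd hL b₀ b₁ (2 * ((d : ℝ) + 1)) ≤ Mstar)
    (hMr : rLB d ℓ + 1 < MInv)
    (h32 : B9.Thm32Printed (d + 1) c35 (fun j => geo9Y (f j)) (fun j => bg9YC (Matrix (Fin N) (Fin N) ℂ) G (extraYPb (Matrix (Fin N) (Fin N) ℂ) G) (f j)) (CinvY (extraYPb (Matrix (Fin N) (Fin N) ℂ) G) f G (fun j => parSymY (f j).toKIdx)))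
    (h33 : B9.Thm33Printed c35 (fun j => geo9Y (f j)) (fun j => bg9YC (Matrix (Fin N) (Fin N) ℂ) G (extraYPb (Matrix (Fin N) (Fin N) ℂ) G) (f j))
      (fun j => kernelFamilyS (f j).toKIdx (bg9YC (Matrix (Fin N) (Fin N) ℂ) G (extraYPb (Matrix (Fin N) (Fin N) ℂ) G) (f j)) (fun U => U) (GpY (f j).toKIdx (parSymY (f j).toKIdx))
        (parSymY (f j).toKIdx))
      (fun j => kernelFamilyB (f j).toKIdx (bg9YC (Matrix (Fin N) (Fin N) ℂ) G (extraYPb (Matrix (Fin N) (Fin N) ℂ) G) (f j)) (fun U => U)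
        (GAY (f j).toKIdx (parSymY (f j).toKIdx) (parBY (f j).toKIdx) (GpY (f j).toKIdx (parSymY (f j).toKIdx))) (parBY (f j).toKIdx))) :
    SectBStepU (extraYPb (Matrix (Fin N) (Fin N) ℂ) G) f (d + 1) c35 G b (fun j => parSymY (f j).toKIdx)
      (fun j => GAY (f j).toKIdx (parSymY (f j).toKIdx) (parBY (f j).toKIdx) (GpY (f j).toKIdx (parSymY (f j).toKIdx))) (fun j => parBY (f j).toKIdx)
      (fun j => C37GY G (f j) (ιB j) (4 * ((d : ℝ) + 1) * Real.exp (3 * (((d : ℝ) + 1) / 2)))) C38 (CinvY (extraYPb (Matrix (Fin N) (Fin N) ℂ) G) f G (fun j => parSymY (f j).toKIdx)) :=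
  sectBStepU_C37GY_unitary_extraYPb_d261Y f c35 G b ιB C38 hG hι hG1 (coordBound39 b) (norm_nonneg _) (abs_repr_le b) (hcR_of_basis b) (hcL_of_basis b)
    MInv aInv aW hMInv haInv haW hunitA hb₁ hMd (nbrCountY d ℓ hd hL b₀ b₁ (2 * ((d : ℝ) + 1))) (fun j y' => hnbr_of_le hM₀B (f j) y') hMr h32 h33

/-- ★★ Theorem 3.4 in U-letters at the record's reading of print's class, structural binders discharged (over `sectBStepU_C37GY_unitary_extraYPb_d261Y_std`'s inputs,
by `B9SectBStepUGuardedR.thm34U_C37GY_unitary_extraYPb_d261Y`). [cite: Balaban1985BackgroundPropagators, Thm 3.4 p.400; Balaban1984PropagatorsII, Lemma 2.1 p.234] -/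
theorem thm34U_C37GY_unitary_extraYPb_d261Y_std [Nonempty (Fin N)] [NormOneClass (Matrix (Fin N) (Fin N) ℂ)] [FiniteDimensional ℝ (Matrix (Fin N) (Fin N) ℂ)]
    (hG : G ≤ B7Prop2Explicit.unitaryUnits (Matrix (Fin N) (Fin N) ℂ))
    (hι : ∀ (j : J) (s : BlkY (f j).toKIdx), β (f j).toKIdx.hN (f j).toKIdx.D (f j).toKIdx.hk (ιB j s) = s)
    (hG1 : ∀ u : (Matrix (Fin N) (Fin N) ℂ)ˣ, u ∈ G → ‖(u : Matrix (Fin N) (Fin N) ℂ)‖ ≤ 1)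
    (MInv aInv aW : ℝ) (hMInv : 0 < MInv) (haInv : 0 < aInv) (haW : 0 < aW)
    (hunitA : ∀ j (α₀ : ℝ) (U : CfgY (Matrix (Fin N) (Fin N) ℂ) (f j).toKIdx), MInv ≤ (geo9Y (f j)).M → 0 < α₀ → (geo9Y (f j)).M * α₀ ≤ aInv →
      (bg9YC (Matrix (Fin N) (Fin N) ℂ) G (extraYPb (Matrix (Fin N) (Fin N) ℂ) G) (f j)).Reg335 c35 α₀ U →
      IsUnit (deltaAY (f j).toKIdx (parSymY (f j).toKIdx) (parBY (f j).toKIdx) (GpY (f j).toKIdx (parSymY (f j).toKIdx)) U)) (hb₁ : 0 ≤ b₁)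
    (hMd : 2 * ((d : ℝ) + 1) < MInv) (hM₀B : nbrM₀Y d ℓ hd hL b₀ b₁ (2 * ((d : ℝ) + 1)) ≤ Mstar)
    (hMr : rLB d ℓ + 1 < MInv)
    (h32 : B9.Thm32Printed (d + 1) c35 (fun j => geo9Y (f j)) (fun j => bg9YC (Matrix (Fin N) (Fin N) ℂ) G (extraYPb (Matrix (Fin N) (Fin N) ℂ) G) (f j)) (CinvY (extraYPb (Matrix (Fin N) (Fin N) ℂ) G) f G (fun j => parSymY (f j).toKIdx)))
    (h33 : B9.Thm33Printed c35 (fun j => geo9Y (f j)) (fun j => bg9YC (Matrix (Fin N) (Fin N) ℂ) G (extraYPb (Matrix (Fin N) (Fin N) ℂ) G) (f j))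
      (fun j => kernelFamilyS (f j).toKIdx (bg9YC (Matrix (Fin N) (Fin N) ℂ) G (extraYPb (Matrix (Fin N) (Fin N) ℂ) G) (f j)) (fun U => U) (GpY (f j).toKIdx (parSymY (f j).toKIdx))
        (parSymY (f j).toKIdx))
      (fun j => kernelFamilyB (f j).toKIdx (bg9YC (Matrix (Fin N) (Fin N) ℂ) G (extraYPb (Matrix (Fin N) (Fin N) ℂ) G) (f j)) (fun U => U)
        (GAY (f j).toKIdx (parSymY (f j).toKIdx) (parBY (f j).toKIdx) (GpY (f j).toKIdx (parSymY (f j).toKIdx))) (parBY (f j).toKIdx))) :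
    Thm34U (extraYPb (Matrix (Fin N) (Fin N) ℂ) G) f c35 G b (fun j => parSymY (f j).toKIdx)
      (fun j => GAY (f j).toKIdx (parSymY (f j).toKIdx) (parBY (f j).toKIdx) (GpY (f j).toKIdx (parSymY (f j).toKIdx))) (fun j => parBY (f j).toKIdx)
      (fun j => C37GY G (f j) (ιB j) (4 * ((d : ℝ) + 1) * Real.exp (3 * (((d : ℝ) + 1) / 2)))) C38 :=
  thm34U_C37GY_unitary_extraYPb_d261Y f c35 G b ιB C38 hG hι hG1 (coordBound39 b) (norm_nonneg _) (abs_repr_le b) (hcR_of_basis b) (hcL_of_basis b)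
    MInv aInv aW hMInv haInv haW hunitA hb₁ hMd (nbrCountY d ℓ hd hL b₀ b₁ (2 * ((d : ℝ) + 1))) (fun j y' => hnbr_of_le hM₀B (f j) y') hMr h32 h33

end Face

end Literature.MathematicalPhysics.QuantumFieldTheory.Balaban1983to89.B9SectBStepUStructuralKit

end
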